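import Summits.CriticalPhenomena.PercolationContinuityZ3.Theorems.PercNearOneGluingNoHeavyQuantOneBigCert
import Summits.CriticalPhenomena.PercolationContinuityZ3.Theorems.PercNearOneGluingNoHeavyQuantTwoBig
import Summits.CriticalPhenomena.PercolationContinuityZ3.Theorems.PercNearOneGluingNoHeavyQuantDIBStarFloorSplitInductionTwoBigs
import HarnessLib

/-!
# QUANT lane R8, Conjecture DIB\* — T-DIB REDUCED TO ONE REAL INEQUALITY: the j-CLOUD TWO-BIG certificate (`TwoBigCertJ`), its kernel
# reduction, and `TwoBigCertJ → ∀ x < 1, DIBStar x`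

builds on p205010 (kernel theorem, internal audit signed; external expert review pending)

Statement + support file (`--supports stmt-CriticalPhenomena-4575`), QUANT lane seat prim-quant-p1 (gen 13, owner of `TwoBigCertJ` per README V232);
numerics `run/sessions/prover-prim-quant-p1-g13-0/folder/work/num/` (copied to `run/shared/lean/prim/quant/prim-quant-p1-g13/`), lane INBOX 13:35Z/15:05Z.
TWO `Prop` definitions (`TwoBigCertJAt b₁ b₂ j`, a closed-form real inequality, and the `@[conjecture]` `TwoBigCertJ := ∀ b₁ b₂ j, TwoBigCertJAt b₁ b₂ j`),
theorems otherwise; no sorries, standard axioms.  Companion of lead g19's `…QuantTwoBig` (`TwoBigCertAt`: the same binder with the HONEST-F2 cloud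
bound `V ≤ (j/2)·s2`); this file's binder has `V ≤ j·s2` and therefore serves EVERY system with at least two blobs of size `> j/2`.

THE RESIDUAL CLASS OF T-DIB after CELL F1 (`RootDec.tail_ge_of_oneBig`, p274645) is `StepLemmaFSTwoBigs` (p275161): at least TWO blobs of size
`> j/2`.  THE OBSERVATION: condition on ANY two blobs `k₁ ≠ k₂` of size `> j/2` (they complete each other) by `RootDec.term_cond` twice —
`P(N ≥ j+1) = p₁p₂ + p₁q₂·TERM[a k₁, rest] + p₂q₁·TERM[a k₂, rest] + q₁q₂·TERM[0, rest]` — and put EVERY other blob, the other bigs included,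
into the cloud.  The cloud's blobs have sizes `≤ j` (not `≤ j/2`), so its variance obeys only `V ≤ j·s2`; its three terms are bounded by the kernel
rules 0 | Markov on the closed mass | Cantelli through the aggregates `A, m, s2, V, c` exactly as in `…QuantOneBig` / `…QuantTwoBig`.

* `Quant.IndepBlob.TwoBigCertJAt b₁ b₂ j`, `Quant.IndepBlob.TwoBigCertJ` (`@[conjecture]`) — the real inequality.  NUMERICALLY TRUE with infimum
  margin `0.122·(1−x)` (after the chains of `…QuantOneBigCert` with `k = j(1−x)` it is a piecewise-rational inequality in five variables; grid
  `1.5·10⁶` + hill-climbs + small-`y` sweep; worst point `y ≈ 0.34`, `a k₁ = j`, `a k₂ ≈ 0.52j`, both gates at the kink `x`, cloud credit exactly `j`;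
  chain validated against the exact law on `26 304` random systems with 2–4 bigs).  `TwoBigCertJAt → TwoBigCertAt` (`twoBigCertAt_of_J`).
  Its proof (segment reduction + 42 Handelman leaves) is filed separately (`…QuantTwoBigSeg`, `…QuantTwoBigJLeaves*`, `…QuantTwoBigJFinal*`).
* **`Quant.RootDec.twoBigJ_row_of_certAt`** — the kernel reduction (all sizes `≤ j`, gates in `[x², 1]`, floor `1/2 ≤ x < 1`, credit `> 2j`).
* **`Quant.IndepBlob.stepLemmaFSTwoBigs_of_twoBigCertJ`, `Quant.IndepBlob.dibStar_of_twoBigCertJ : TwoBigCertJ → ∀ x < 1, DIBStar x`.**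
[this work]; the gluing rows served [cite: KozmaNitzan2024, Conjecture 3 (p. 15)]; product weights [cite: Grimmett1999, §1.3 p. 10].
-/

namespace Summit.CriticalPhenomena.PercolationContinuityZ3.Theorems

namespace Quant

open Finset

namespace IndepBlob

/-- **THE j-CLOUD TWO-BIG CERTIFICATE for big sizes `b₁, b₂` at layer `j`** (a closed-form real inequality; p1 g13).  Data: floor `x`; the two
conditioned blobs' gates `p₁, p₂`; the cloud aggregates `A` (total size), `m` (mean), `s2 = Σ a g(1−g)`, `V = Σ a² g(1−g)`, `c` (discounted credit).
Hypotheses = the credit hypothesis split at the two bigs + the aggregate constraints of `…QuantOneBig` with the variance bound `V ≤ j·s2` (cloud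
sizes `≤ j`).  Conclusion: menu items `z₁` (level `j − b₁`), `z₂` (level `j − b₂`), `z₀` (level `j`), each 0 | Markov on the closed mass | Cantelli,
with `x ≤ p₁p₂ + p₁(1−p₂)z₁ + (1−p₁)p₂z₂ + (1−p₁)(1−p₂)z₀`.  Same binder as lead g19's `TwoBigCertAt` except for the cloud bound. [this work] -/
def TwoBigCertJAt (b₁ b₂ j : ℕ) : Prop :=
  ∀ (x p₁ p₂ A m s2 V c : ℝ),
    1 / 2 ≤ x → x < 1 → x ^ 2 ≤ p₁ → p₁ ≤ 1 → x ^ 2 ≤ p₂ → p₂ ≤ 1 →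
    j < 2 * b₁ → b₁ ≤ j → j < 2 * b₂ → b₂ ≤ j →
    (2 * j : ℝ) < (b₁ : ℝ) * (if x ≤ p₁ then p₁ else (p₁ - x ^ 2) / (1 - x))
      + (b₂ : ℝ) * (if x ≤ p₂ then p₂ else (p₂ - x ^ 2) / (1 - x)) + c →
    c ≤ m → x ^ 2 * A + (1 - x) * c ≤ m → m ≤ A →
    0 ≤ V → 0 ≤ s2 → s2 ≤ (1 - x) * (2 * m - c) → s2 ≤ m → s2 ≤ A - m →
    V ≤ (j : ℝ) * s2 →
    ∃ z₁ z₂ z₀ : ℝ,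
      (z₁ ≤ 0 ∨ (((j - b₁ : ℕ) : ℝ) < A ∧ z₁ ≤ 1 - (A - m) / (A - ((j - b₁ : ℕ) : ℝ)))
        ∨ (((j - b₁ : ℕ) : ℝ) < m ∧ z₁ ≤ 1 - V / (V + (m - ((j - b₁ : ℕ) : ℝ)) ^ 2))) ∧
      (z₂ ≤ 0 ∨ (((j - b₂ : ℕ) : ℝ) < A ∧ z₂ ≤ 1 - (A - m) / (A - ((j - b₂ : ℕ) : ℝ)))
        ∨ (((j - b₂ : ℕ) : ℝ) < m ∧ z₂ ≤ 1 - V / (V + (m - ((j - b₂ : ℕ) : ℝ)) ^ 2))) ∧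
      (z₀ ≤ 0 ∨ ((j : ℝ) < A ∧ z₀ ≤ 1 - (A - m) / (A - j)) ∨ ((j : ℝ) < m ∧ z₀ ≤ 1 - V / (V + (m - j) ^ 2))) ∧
      x ≤ p₁ * p₂ + p₁ * (1 - p₂) * z₁ + (1 - p₁) * p₂ * z₂ + (1 - p₁) * (1 - p₂) * z₀

/-- **CONJECTURE — the j-cloud two-big certificate for all big sizes**: `∀ b₁ b₂ j, TwoBigCertJAt b₁ b₂ j`.  Numerically true, infimum margin
`0.122(1−x)` (module docstring); implies lead g19's `TwoBigCert` (`twoBigCert_of_J`) and, with CELL F1, the whole of T-DIB (`dibStar_of_twoBigCertJ`).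
builds on p205010 (kernel theorem, internal audit signed; external expert review pending). [this work] [status: open] -/
@[conjecture] def TwoBigCertJ : Prop := ∀ b₁ b₂ j : ℕ, TwoBigCertJAt b₁ b₂ j

/-- The j-cloud binder implies the honest-F2 binder (`V ≤ (j/2)·s2 ≤ j·s2`). [this work] -/
theorem twoBigCertAt_of_J {b₁ b₂ j : ℕ} (h : TwoBigCertJAt b₁ b₂ j) : TwoBigCertAt b₁ b₂ j := by
  intro x p₁ p₂ A m s2 V c hx hx1 hp₁ hp₁1 hp₂ hp₂1 hjb₁ hb₁j hjb₂ hb₂j hcred hcm hclosed hmA hV0 hs20 hs2c hs2m hs2E hVj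
  refine h x p₁ p₂ A m s2 V c hx hx1 hp₁ hp₁1 hp₂ hp₂1 hjb₁ hb₁j hjb₂ hb₂j hcred hcm hclosed hmA hV0 hs20 hs2c hs2m hs2E ?_
  have hj0 : (0 : ℝ) ≤ (j : ℝ) := Nat.cast_nonneg j
  nlinarith

/-- `TwoBigCertJ → TwoBigCert` (lead g19's honest-F2 certificate). [this work] -/
theorem twoBigCert_of_J (h : TwoBigCertJ) : TwoBigCert := fun b₁ b₂ j => twoBigCertAt_of_J (h b₁ b₂ j)

end IndepBlob

namespace RootDec

variable {κ : Type} [Fintype κ] [DecidableEq κ]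

/-- product-Bernoulli weight of the set `W` of open blobs (as in `…QuantRootReduction`) -/
local notation3 "wt[" g ", " W "]" => ∏ k, (if k ∈ (W : Finset κ) then (g : κ → ℝ) k else 1 - (g : κ → ℝ) k)

/-- the TERM tail `P(s + Σ_{k open} a k ≥ j+1)` (as in `…QuantRootReduction`) -/
local notation3 "TERM[" s ", " a ", " g ", " j "]" =>
  ∑ W : Finset κ, wt[g, W] * (if (j : ℕ) + 1 ≤ (s : ℕ) + ∑ k ∈ W, (a : κ → ℕ) k then (1 : ℝ) else 0)

/-- The three-way menu at one level (0 | Markov | Cantelli), discharged: `term_ge_of_menu` without the disjunction item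
(as lead g19's `term_ge_of_menu3`, without the unused floor argument). [this work] -/
theorem term_ge_of_menu3'  (s : ℕ) (a : κ → ℕ) (g : κ → ℝ) (j : ℕ) (hg : ∀ i, 0 ≤ g i ∧ g i ≤ 1) (hs : s ≤ j) (t : ℝ)
    (ht : ((j - s : ℕ) : ℝ) = t) (z : ℝ)
    (hz : z ≤ 0 ∨ (t < ∑ i, (a i : ℝ) ∧ z ≤ 1 - ((∑ i, (a i : ℝ)) - ∑ i, (a i : ℝ) * g i) / ((∑ i, (a i : ℝ)) - t))
        ∨ (t < ∑ i, (a i : ℝ) * g i ∧ z ≤ 1 - (∑ i, (a i : ℝ) ^ 2 * g i * (1 - g i)) /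
            ((∑ i, (a i : ℝ) ^ 2 * g i * (1 - g i)) + ((∑ i, (a i : ℝ) * g i) - t) ^ 2))) :
    z ≤ TERM[s, a, g, j] := by
  refine term_ge_of_menu s a g j hg hs t ht 0 z ∅ (fun i hi => absurd hi (Finset.notMem_empty i))
    (fun i hi => absurd hi (Finset.notMem_empty i)) ?_
  rcases hz with h | h | h
  · exact Or.inl h
  · exact Or.inr (Or.inl h)
  · exact Or.inr (Or.inr (Or.inl h))

/-- **Conditioning on two mutually completing blobs** (`term_cond` twice): for `k₁ ≠ k₂` with `j + 1 ≤ a k₁ + a k₂` and `a''` = `a` with both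
emptied, `P(N ≥ j+1) = p₁p₂ + p₁q₂·TERM[a k₁, a''] + p₂q₁·TERM[a k₂, a''] + q₁q₂·TERM[0, a'']`. [this work] -/
theorem term_cond_two (a : κ → ℕ) (g : κ → ℝ) (j : ℕ) (k₁ k₂ : κ) (hne : k₁ ≠ k₂) (hcomp : j + 1 ≤ a k₁ + a k₂) :
    TERM[0, a, g, j] = g k₁ * g k₂
      + g k₁ * (1 - g k₂) * TERM[a k₁, Function.update (Function.update a k₁ 0) k₂ 0, g, j]
      + g k₂ * (1 - g k₁) * TERM[a k₂, Function.update (Function.update a k₁ 0) k₂ 0, g, j]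
      + (1 - g k₁) * (1 - g k₂) * TERM[0, Function.update (Function.update a k₁ 0) k₂ 0, g, j] := by
  have hk₂ : Function.update a k₁ 0 k₂ = a k₂ := Function.update_of_ne hne.symm _ _
  rw [term_cond 0 a g j k₁, term_cond (0 + a k₁) (Function.update a k₁ 0) g j k₂,
    term_cond 0 (Function.update a k₁ 0) g j k₂, hk₂,
    term_eq_one_of_sure (0 + a k₁ + a k₂) _ g j (by omega)]
  simp only [zero_add]
  ring

/-- **T-DIB's residual class REDUCED: `TwoBigCertJAt (a k₁) (a k₂) j` ⟹ the DIB\* row for a system with two blobs `k₁ ≠ k₂` of size `> j/2`** (floor `1/2 ≤ x < 1`,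
gates in `[x², 1]`, all sizes `≤ j`, blobs `k₁ ≠ k₂` with `j < 2·a kᵢ`, credit `> 2j`; any further blobs of size `> j/2` sit in the cloud).
Proof: `term_cond_two`; the cloud's aggregates satisfy the constraints of `TwoBigCert` blob by blob (`V ≤ j·s2` from sizes `≤ j`); the menu
items are discharged by `term_ge_of_menu3'`. [this work] -/
theorem twoBigJ_row_of_certAt (a : κ → ℕ) (g : κ → ℝ) (j : ℕ) (x : ℝ) (k₁ k₂ : κ) (hC : IndepBlob.TwoBigCertJAt (a k₁) (a k₂) j)
    (hx : 1 / 2 ≤ x) (hx1 : x < 1)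
    (hg : ∀ i, 0 ≤ g i ∧ g i ≤ 1) (hjunk : ∀ i, x ^ 2 ≤ g i) (hne : k₁ ≠ k₂) (hbig₁ : j < 2 * a k₁)
    (hbig₂ : j < 2 * a k₂) (hsize : ∀ i, a i ≤ j)
    (hcredit : (2 * j : ℝ) < ∑ i, (a i : ℝ) * (if x ≤ g i then g i else (g i - x ^ 2) / (1 - x))) :
    x ≤ ∑ W : Finset κ, wt[g, W] * (if j + 1 ≤ ∑ i ∈ W, a i then (1 : ℝ) else 0) := by
  have hx0 : 0 ≤ x := by linarith
  set φ : κ → ℝ := fun i => if x ≤ g i then g i else (g i - x ^ 2) / (1 - x) with hφ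
  set b₁ : ℕ := a k₁ with hb₁
  set b₂ : ℕ := a k₂ with hb₂
  set a' : κ → ℕ := Function.update (Function.update a k₁ 0) k₂ 0 with ha'
  have ha'k₂ : a' k₂ = 0 := by simp [ha']
  have ha'k₁ : a' k₁ = 0 := by simp [ha', Function.update_of_ne hne]
  have ha'ne : ∀ i, i ≠ k₁ → i ≠ k₂ → a' i = a i := fun i h₁ h₂ => by
    simp [ha', Function.update_of_ne h₂, Function.update_of_ne h₁]
  have ha'le : ∀ i, a' i ≤ j := by
    intro i
    by_cases h₁ : i = k₁
    · rw [h₁, ha'k₁]; exact Nat.zero_le _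
    by_cases h₂ : i = k₂
    · rw [h₂, ha'k₂]; exact Nat.zero_le _
    rw [ha'ne i h₁ h₂]; exact hsize i
  -- split P(N ≥ j+1) at the two bigs
  have e := term_cond_two a g j k₁ k₂ hne (by omega)
  have e0 : TERM[0, a, g, j] = ∑ W : Finset κ, wt[g, W] * (if j + 1 ≤ ∑ i ∈ W, a i then (1 : ℝ) else 0) := by
    simp only [zero_add]
  rw [← e0, e, show a k₁ = b₁ from rfl, show a k₂ = b₂ from rfl, show Function.update (Function.update a k₁ 0) k₂ 0 = a' from rfl]
  -- the credit of the cloud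
  have hrest : ∑ i, (a' i : ℝ) * φ i = (∑ i, (a i : ℝ) * φ i) - b₁ * φ k₁ - b₂ * φ k₂ := by
    have hk₂m : k₂ ∈ Finset.univ.erase k₁ := Finset.mem_erase.2 ⟨hne.symm, Finset.mem_univ k₂⟩
    have split : ∀ f : κ → ℝ, ∑ i, f i = f k₁ + (f k₂ + ∑ i ∈ (Finset.univ.erase k₁).erase k₂, f i) := by
      intro f
      rw [← Finset.add_sum_erase _ _ (Finset.mem_univ k₁), ← Finset.add_sum_erase _ _ hk₂m]
    have h3 : ∑ i ∈ (Finset.univ.erase k₁).erase k₂, (a' i : ℝ) * φ i = ∑ i ∈ (Finset.univ.erase k₁).erase k₂, (a i : ℝ) * φ i :=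
      Finset.sum_congr rfl fun i hi => by
        rw [ha'ne i (Finset.ne_of_mem_erase (Finset.mem_of_mem_erase hi)) (Finset.ne_of_mem_erase hi)]
    rw [split (fun i => (a' i : ℝ) * φ i), split (fun i => (a i : ℝ) * φ i), h3, ha'k₁, ha'k₂, Nat.cast_zero, zero_mul, zero_mul,
      zero_add, zero_add, hb₁, hb₂]
    ring
  -- pointwise facts about the cloud
  have ha'0 : ∀ i, (0 : ℝ) ≤ a' i := fun i => Nat.cast_nonneg _
  have hgg : ∀ i, 0 ≤ g i * (1 - g i) := fun i => mul_nonneg (hg i).1 (sub_nonneg.2 (hg i).2)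
  have hag : ∀ i, 0 ≤ (a' i : ℝ) * g i := fun i => mul_nonneg (ha'0 i) (hg i).1
  -- (c1) credit ≤ mean
  have hc1 : ∑ i, (a' i : ℝ) * φ i ≤ ∑ i, (a' i : ℝ) * g i := Finset.sum_le_sum fun i _ =>
    mul_le_mul_of_nonneg_left (IndepBlob.phi_le_gate x (g i) hx0 hx1) (ha'0 i)
  -- (c2) the closed-mass constraint
  have hc2 : x ^ 2 * (∑ i, (a' i : ℝ)) + (1 - x) * (∑ i, (a' i : ℝ) * φ i) ≤ ∑ i, (a' i : ℝ) * g i := by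
    rw [Finset.mul_sum, Finset.mul_sum, ← Finset.sum_add_distrib]
    refine Finset.sum_le_sum fun i _ => ?_
    have h := mul_le_mul_of_nonneg_left (IndepBlob.gate_ge_floorSq_add x (g i) hx0 hx1) (ha'0 i)
    have e : x ^ 2 * (a' i : ℝ) + (1 - x) * ((a' i : ℝ) * φ i) = (a' i : ℝ) * (x ^ 2 + (1 - x) * φ i) := by ring
    rw [e]; exact h
  -- (c3) the variance constraint
  have hc3 : ∑ i, (a' i : ℝ) * g i * (1 - g i) ≤ (1 - x) * (2 * (∑ i, (a' i : ℝ) * g i) - ∑ i, (a' i : ℝ) * φ i) := by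
    rw [Finset.mul_sum, ← Finset.sum_sub_distrib, Finset.mul_sum]
    refine Finset.sum_le_sum fun i _ => ?_
    have h := mul_le_mul_of_nonneg_left (IndepBlob.gate_var_le x (g i) hx0 hx1) (ha'0 i)
    have e1 : (a' i : ℝ) * g i * (1 - g i) = (a' i : ℝ) * (g i * (1 - g i)) := by ring
    have e2 : (1 - x) * (2 * ((a' i : ℝ) * g i) - (a' i : ℝ) * φ i) = (a' i : ℝ) * ((1 - x) * (2 * g i - φ i)) := by ring
    rw [e1, e2]; exact h
  have hs2m : ∑ i, (a' i : ℝ) * g i * (1 - g i) ≤ ∑ i, (a' i : ℝ) * g i :=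
    Finset.sum_le_sum fun i _ => by nlinarith [hag i, (hg i).1, (hg i).2]
  have hs2E : ∑ i, (a' i : ℝ) * g i * (1 - g i) ≤ (∑ i, (a' i : ℝ)) - ∑ i, (a' i : ℝ) * g i := by
    rw [← Finset.sum_sub_distrib]
    exact Finset.sum_le_sum fun i _ => by nlinarith [mul_nonneg (ha'0 i) (sq_nonneg (1 - g i))]
  have hs20 : 0 ≤ ∑ i, (a' i : ℝ) * g i * (1 - g i) :=
    Finset.sum_nonneg fun i _ => by rw [mul_assoc]; exact mul_nonneg (ha'0 i) (hgg i)
  have hV0 : 0 ≤ ∑ i, (a' i : ℝ) ^ 2 * g i * (1 - g i) :=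
    Finset.sum_nonneg fun i _ => by rw [mul_assoc]; exact mul_nonneg (sq_nonneg _) (hgg i)
  have hmA : ∑ i, (a' i : ℝ) * g i ≤ ∑ i, (a' i : ℝ) :=
    Finset.sum_le_sum fun i _ => by nlinarith [ha'0 i, (hg i).2]
  -- (c4) V ≤ j·s2 (cloud sizes ≤ j)
  have hc4 : ∑ i, (a' i : ℝ) ^ 2 * g i * (1 - g i) ≤ (j : ℝ) * ∑ i, (a' i : ℝ) * g i * (1 - g i) := by
    rw [Finset.mul_sum]
    refine Finset.sum_le_sum fun i _ => ?_
    have h : (a' i : ℝ) ≤ j := by exact_mod_cast ha'le i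
    have h1 : (a' i : ℝ) ^ 2 ≤ (j : ℝ) * (a' i : ℝ) := by nlinarith [ha'0 i]
    have e1 : (a' i : ℝ) ^ 2 * g i * (1 - g i) = (a' i : ℝ) ^ 2 * (g i * (1 - g i)) := by ring
    have e2 : (j : ℝ) * ((a' i : ℝ) * g i * (1 - g i)) = ((j : ℝ) * (a' i : ℝ)) * (g i * (1 - g i)) := by ring
    rw [e1, e2]
    exact mul_le_mul_of_nonneg_right h1 (hgg i)
  -- the certificate
  have hcred' : (2 * j : ℝ) < (b₁ : ℝ) * φ k₁ + (b₂ : ℝ) * φ k₂ + ∑ i, (a' i : ℝ) * φ i := by rw [hrest]; linarith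
  have hφk₁ : φ k₁ = (if x ≤ g k₁ then g k₁ else (g k₁ - x ^ 2) / (1 - x)) := rfl
  have hφk₂ : φ k₂ = (if x ≤ g k₂ then g k₂ else (g k₂ - x ^ 2) / (1 - x)) := rfl
  rw [hφk₁, hφk₂] at hcred'
  obtain ⟨z₁, z₂, z₀, hz₁, hz₂, hz₀, hxz⟩ := hC x (g k₁) (g k₂) (∑ i, (a' i : ℝ)) (∑ i, (a' i : ℝ) * g i)
    (∑ i, (a' i : ℝ) * g i * (1 - g i)) (∑ i, (a' i : ℝ) ^ 2 * g i * (1 - g i)) (∑ i, (a' i : ℝ) * φ i)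
    hx hx1 (hjunk k₁) (hg k₁).2 (hjunk k₂) (hg k₂).2 hbig₁ (hsize k₁) hbig₂ (hsize k₂) hcred' hc1 hc2 hmA hV0 hs20 hc3 hs2m hs2E hc4
  -- discharge the menu items
  have h1 : z₁ ≤ TERM[b₁, a', g, j] := term_ge_of_menu3' b₁ a' g j hg (hsize k₁) ((j - b₁ : ℕ) : ℝ) rfl z₁ hz₁
  have h2 : z₂ ≤ TERM[b₂, a', g, j] := term_ge_of_menu3' b₂ a' g j hg (hsize k₂) ((j - b₂ : ℕ) : ℝ) rfl z₂ hz₂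
  have h0 : z₀ ≤ TERM[0, a', g, j] := term_ge_of_menu3' 0 a' g j hg (Nat.zero_le j) (j : ℝ) (by simp) z₀ hz₀
  have e1 := mul_le_mul_of_nonneg_left h1 (mul_nonneg (hg k₁).1 (sub_nonneg.2 (hg k₂).2))
  have e2 := mul_le_mul_of_nonneg_left h2 (mul_nonneg (hg k₂).1 (sub_nonneg.2 (hg k₁).2))
  have e0' := mul_le_mul_of_nonneg_left h0 (mul_nonneg (sub_nonneg.2 (hg k₁).2) (sub_nonneg.2 (hg k₂).2))
  linarith

/-- **DIB\* for every system with (at least) two blobs of size `> j/2`, conditionally on `TwoBigCertJ`** — the plain-sum form of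
`twoBigJ_row_of_certAt`. [this work] -/
theorem tail_ge_of_twoBigJ (hC : IndepBlob.TwoBigCertJ) (a : κ → ℕ) (g : κ → ℝ) (j : ℕ) (x : ℝ) (hx : 1 / 2 ≤ x) (hx1 : x < 1)
    (hg : ∀ i, 0 ≤ g i ∧ g i ≤ 1) (hjunk : ∀ i, x ^ 2 ≤ g i) (k₁ k₂ : κ) (hne : k₁ ≠ k₂) (hbig₁ : j < 2 * a k₁)
    (hbig₂ : j < 2 * a k₂) (hsize : ∀ i, a i ≤ j)
    (hcredit : (2 * j : ℝ) < ∑ i, (a i : ℝ) * (if x ≤ g i then g i else (g i - x ^ 2) / (1 - x))) :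
    x ≤ ∑ W : Finset κ, (∏ i, if i ∈ W then g i else 1 - g i) * (if j + 1 ≤ ∑ i ∈ W, a i then (1 : ℝ) else 0) :=
  twoBigJ_row_of_certAt a g j x k₁ k₂ (hC (a k₁) (a k₂) j) hx hx1 hg hjunk hne hbig₁ hbig₂ hsize hcredit

end RootDec

namespace IndepBlob

/-- **THE ASSEMBLY: `TwoBigCertJ` ⟹ the step lemma on the open class `StepLemmaFSTwoBigs`** (p275161).  On that class every gate is `≥ x²`
(non-empty lights by hypothesis, heavies `≥ x ≥ x²`, empty blobs have gate `1`), every size is `≤ j`, and there are two distinct blobs of size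
`> j/2`: `RootDec.tail_ge_of_twoBigJ`.  The induction hypothesis and the remaining hypotheses of the class are not needed. [this work] -/
theorem stepLemmaFSTwoBigs_of_twoBigCertJ (hC : TwoBigCertJ) : StepLemmaFSTwoBigs := by
  intro κ _ _ a g j x hx hx1 hg hlight _ hnogiant _ _ hcore _ hempty _ _ htwo _ hcredit _
  -- gates ≥ x²
  have hjunk : ∀ i, x ^ 2 ≤ g i := by
    intro i
    by_cases h0 : a i = 0
    · rw [hempty i h0]; nlinarith
    by_cases hl : g i < x
    · exact (hcore i hl (Nat.pos_of_ne_zero h0)).le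
    · nlinarith [not_lt.1 hl]
  -- sizes ≤ j
  have hsize : ∀ i, a i ≤ j := by
    intro i
    by_cases hl : g i < x
    · exact hlight i hl
    · exact hnogiant i (not_lt.1 hl)
  obtain ⟨k₁, k₂, hne, hk₁, hk₂⟩ := htwo
  exact RootDec.tail_ge_of_twoBigJ hC a g j x hx.le hx1 hg hjunk k₁ k₂ hne hk₁ hk₂ hsize hcredit

/-- **T-DIB REDUCED TO ONE REAL INEQUALITY: `TwoBigCertJ → DIBStar x` for every floor `x < 1`.** [this work] -/
theorem dibStar_of_twoBigCertJ (hC : TwoBigCertJ) (x : ℝ) (hx1 : x < 1) : DIBStar x :=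
  dibStar_of_stepLemmaFSTwoBigs (stepLemmaFSTwoBigs_of_twoBigCertJ hC) x hx1

end IndepBlob

end Quant

end Summit.CriticalPhenomena.PercolationContinuityZ3.Theorems
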